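import Summits.QuantumFields.YangMills.Theorems.BalabanUVNodesN12LeafIntAtRecord13
import Literature.MathematicalPhysics.QuantumFieldTheory.Balaban1983to89.Node00.Record13CarriersWChi

/-!
# BalabanUVNodes ∕ N12 — χ-GENERIC RE-ISSUE (WORK ORDER RC-1 «RE-CENTRE THE RECORD», director-ym №462 (B) ∕ №467 (D); dag-lead g40 WORDS 584 GO) of
# `…N12LeafIntAtRecord13` §2: THE [IV] LEAF AT THE χ-GENERIC STAGE-13 BUNDLE OF RECORD `WOfRecord₁₃Chi θ χ λ P`

Cell `pub-ymgap` (HUMAN RULING D-0062), seat `pub-ymgap-dag-n12-d` g36 (R134 N12 [B15] s2 «knit at the record»).  Count-neutral helper of K1ᴬ `stmt-QuantumFields-27239`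
(`StabilityBRunRowsAtRecordR13SepCoPHVAx`, route rev 31∕32), `--kind proof --supports … --as helper`.  THEOREMS ONLY (0 `def`, 0 `instance`, 0 `sorry`).

WHY.  The route's K-cruxes read the RE-CENTRED record since rev 31∕32 ([Ax-2]∕[Ax-3] — `Node00/SmallFieldChi29AxOfRecord`, `Node00/Record13{Ax,Chi,CoPHChi,SepCoPHChi}`: the
Stage-13 chain re-issued GENERIC in the β-slot `χ : ChiSlot F N`).  This seat's kernel σ-closure of N12's junction of record (`N12-SIGMA-CLOSURE-Ax.g36.md`, evidence #2 on
27239) lists the N12-side statements that read the (2.9) centre: the FIRST of them is the parent's `b15Leaf_WOfRecord₁₃_of_provisosInt_massSel` (it reads `WOfRecord₁₃`,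
`reprTOfRecord₁₃`, `gOfRecord₁₃`).  THIS FILE re-issues the parent's §2 (its four Record-13 theorems) VERBATIM over [Ax-3b]'s χ-generic carriers and this seat's
`WOfRecord₁₃Chi` (`Node00/Record13CarriersWChi`), σ = (`gOfRecord₁₃ F N θ ↦ gOfRecord₁₃Chi F N θ χ`, `reprTOfRecord₁₃ ↦ reprTOfRecord₁₃Chi`, `tdensOfRecord₁₃ ↦
tdensOfRecord₁₃Chi`, `WOfRecord₁₃ ↦ WOfRecord₁₃Chi`, `Provisos₁₃ ↦ Provisos₁₃Chi`), same short names in the sibling namespace `…N12LeafIntAtRecord13Chi` (dag-n11-d's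
convention; consumers switch by namespace).  The parent's §1 (the integrable-currency knit, generic in the representation) is CENTRE-BLIND and consumed BY NAME.  At
`χ := chiβOfRecord₁₃ θ` each theorem IS the parent's (definitionally, [Ax-3b]'s `rfl` receipts + `WOfRecord₁₃Chi_chiβ`); at `χ := chiβOfRecord₁₃Ax θ` it is what the
re-centred record's N12 road reads.  NOT re-issued here: `rBasicStep_view₁₃B10YZW_of_massSel` (n10-d's four-pin VIEW `view₁₃B10YZW` has no χ-twin yet — NODE 00's lane).
Nothing of record edited (body-freeze №460 (2)).

HONEST FRAMING.  Kernel bookkeeping BY NAME, χ-generic; Proposition 1 (1.78), (1.80), (1.89), the denominator-mass display and the (1.100) pin equation stay DISPLAYED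
hypotheses; `Provisos₁₃Chi` displayed; nothing of Bałaban's asserted; N12 NOT discharged; K0ᴬ ∕ K1ᴬ ∕ K3ᴬ OPEN; counts unmoved; one finite 𝕋⁴ programme at fixed
`ε = L^{-K}` — NOT continuum ∕ ℝ⁴ ∕ OS; NOT the Yang–Mills mass gap (Clay).
Sources (bookkeeping only): [Balaban1989LargeFieldI] (0.2)–(0.6) pp.176–177, Prop. 1 (1.78) p.194, (1.80) p.195, (1.89) p.198, (1.99)–(1.102) pp.200–201;
[Balaban1988Convergent] (2.18) p.257, (3.25) p.270; [Balaban1987RG1] (2.9) p.266 (the cut-off's centre).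
-/

noncomputable section

open scoped BigOperators ENNReal
open MeasureTheory

namespace Summit.QuantumFields.YangMills.BalabanUVNodes.N12LeafIntAtRecord13Chi

open Literature.MathematicalPhysics.QuantumFieldTheory.Balaban1983to89
open Literature.MathematicalPhysics.QuantumFieldTheory.Balaban1983to89.T4Continuum (T4Family)
open Literature.MathematicalPhysics.QuantumFieldTheory.Balaban1983to89.DagBinding (PrintedCarriers15 B15Leaf)
open Literature.MathematicalPhysics.QuantumFieldTheory.Balaban1983to89.Node00
open B15 (Prop1Printed Ineq180)
open B15.BasicStep (Claim189)
open B15Sect1Statements (rPrime1100 Normalization1102)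
open B15Claim189Assembly (new189 chiPP dom)
open B8Eq17ClassAkV1 (plaqsOf)
open B15RPrime1100OfRep (rPrimeDataOfSel)
open Summit.QuantumFields.YangMills.BalabanUVNodes.N12LeafIntAtRecord13 (normalization1102_rPrimeDataOfSel_int b15Leaf_WOfRepr_of_provisosInt_massSel)

section Record13Chi

variable {F : T4Family} {N : ℕ} [NeZero N] (θ : Stage13Params F N) (χ : ChiSlot F N) (lam : ResidW F N)

/-- **`Provisos₁₃Chi.rstep P k` IS def-R's INTEGRABLE-form provisos of the N12 knit datum at the χ-generic `Tstep rep_k` of record** — regions := the sequences of record at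
level `k+1` along `gOfRecord₁₃Chi θ χ P`, pieces := the pre-𝐑 terms of `reprTOfRecord₁₃Chi θ χ P k`, `Z ↦ Z″ := θ.ppSel P _ (k+1)`, fresh variables `fibOfSeq … (k+1)` — by def-R's
`rfl` bridge `toRepData_towerRepOfRecord_eq` (instance-generic); the verbatim re-issue of the parent's `provisosInt_reprTOfRecord₁₃_of_provisos₁₃` in the β-slot `χ`.
[cite: Balaban1989LargeFieldI, (0.3) p.176; Balaban1988Convergent, (3.25) p.270; Balaban1987RG1, (2.9) p.266 (bookkeeping)] -/
theorem provisosInt_reprTOfRecord₁₃_of_provisos₁₃ (hP : θ.Provisos₁₃Chi F N χ) (P : B12.RunParams) (k : ℕ) [DecidableEq (PBond (F.P P.K) (k + 1))] (hk : k < P.K) :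
    (repDataOfSel (reprTOfRecord₁₃Chi F N θ χ P k) (θ.ppSel P (gOfRecord₁₃Chi F N θ χ P) (k + 1))
      (fibOfSeq F θ.ν θ.τ9 P (gOfRecord₁₃Chi F N θ χ P) (k + 1))).ProvisosInt := by
  have h := hP.rstep P k hk
  rw [toRepData_towerRepOfRecord_eq] at h
  exact h

/-- **(1.102) FOR THE χ-GENERIC `𝐓ρ_k` OF RECORD at the 𝐑-step's (1.100)-reading, FROM `Provisos₁₃Chi` ALONE** (`k < K`): the parent's §1b `normalization1102_rPrimeDataOfSel_int` fed by
`rstep` (`Σ_s t_s = tdensOfRecord₁₃Chi θ χ P k` is `rfl`). [cite: Balaban1989LargeFieldI, (1.102) p.201, (0.4) p.176; Balaban1988Convergent, (3.25) p.270] -/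
theorem normalization1102_reprTOfRecord₁₃_of_provisos₁₃ (hP : θ.Provisos₁₃Chi F N χ) (P : B12.RunParams) (k : ℕ) [DecidableEq (PBond (F.P P.K) (k + 1))]
    (hk : k < P.K) :
    Normalization1102
      (rPrimeDataOfSel (reprTOfRecord₁₃Chi F N θ χ P k) (θ.ppSel P (gOfRecord₁₃Chi F N θ χ P) (k + 1))
        (fibOfSeq F θ.ν θ.τ9 P (gOfRecord₁₃Chi F N θ χ P) (k + 1)))
      (tdensOfRecord₁₃Chi F N θ χ P k) :=
  normalization1102_rPrimeDataOfSel_int _ _ _ (provisosInt_reprTOfRecord₁₃_of_provisos₁₃ θ χ hP P k hk)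

/-- **THE [IV] LEAF AT THE χ-GENERIC STAGE-13 BUNDLE OF RECORD, ANY RUN, FROM THE INTEGRABLE PROVISOS OF THE KNIT DATUM** (displayed): with the (1.100) PIN EQUATION `hpin` on
the layer's 𝐑′-data at the χ-generic ₁₃ tower, the denominator-mass display, the fibre witness, and EXACTLY Proposition 1 (1.78) on `λ.LF P`, (1.80) ∕ (1.89) on `λ.D189 P`
— the verbatim re-issue of the parent's `b15Leaf_WOfRecord₁₃_of_provisosInt_massSel` in the β-slot `χ` (the first N12-side statement of the σ-closure census).
[cite: Balaban1989LargeFieldI, (0.2)–(0.6) p.176, p.176 ll.14–16, Prop. 1 (1.78) p.194, (1.80) p.195, (1.89) p.198, (1.99)–(1.102) pp.200–201; Balaban1987RG1, (2.9) p.266] -/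
theorem b15Leaf_WOfRecord₁₃_of_provisosInt_massSel {P : B12.RunParams}
    (hint : (repDataOfSel (reprTOfRecord₁₃Chi F N θ χ P (lam.kSel P)) (θ.ppSel P (gOfRecord₁₃Chi F N θ χ P) (lam.kSel P + 1))
      (fibOfSeq F θ.ν θ.τ9 P (gOfRecord₁₃Chi F N θ χ P) (lam.kSel P + 1))).ProvisosInt)
    (hpin : lam.D1100 P
      = rPrimeDataOfSel (reprTOfRecord₁₃Chi F N θ χ P (lam.kSel P)) (θ.ppSel P (gOfRecord₁₃Chi F N θ χ P) (lam.kSel P + 1))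
          (fibOfSeq F θ.ν θ.τ9 P (gOfRecord₁₃Chi F N θ χ P) (lam.kSel P + 1)))
    (hmassSel : ∀ s, 0 < ∫ V, rterm (reprTOfRecord₁₃Chi F N θ χ P (lam.kSel P)) (θ.ppSel P (gOfRecord₁₃Chi F N θ χ P) (lam.kSel P + 1) s) V
      ∂(fieldMeasure (F.P P.K) (lam.kSel P + 1) (SU N)))
    (hfib : ∀ s, ∃ s', θ.ppSel P (gOfRecord₁₃Chi F N θ χ P) (lam.kSel P + 1) s' = θ.ppSel P (gOfRecord₁₃Chi F N θ χ P) (lam.kSel P + 1) s ∧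
      0 < ∫ V, rterm (reprTOfRecord₁₃Chi F N θ χ P (lam.kSel P)) s' V ∂(fieldMeasure (F.P P.K) (lam.kSel P + 1) (SU N)))
    (hP1 : Prop1Printed (lam.LF P))
    (h180 : ∀ U, new189 (lam.D189 P) U → ∀ i, (lam.D189 P).h ≤ i → i ≤ (lam.D189 P).k → ∀ q ∈ plaqsOf (dom (lam.D189 P) i),
      Ineq180 ((lam.D189 P).dev0 U q) ((lam.D189 P).ε (lam.D189 P).k) (lam.D189 P).η (lam.D189 P).B₃ (lam.D189 P).B₅ (lam.D189 P).M (lam.D189 P).δ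
        ((lam.D189 P).dist q) (lam.D189 P).O1)
    (h189 : Claim189 (new189 (lam.D189 P)) (chiPP (lam.D189 P))) : B15Leaf (WOfRecord₁₃Chi F N θ χ lam P) :=
  b15Leaf_WOfRepr_of_provisosInt_massSel _ _ _ (lam.LF P) (lam.D189 P) (lam.D1100 P) hint hpin hmassSel hfib hP1 h180 h189

/-- **★★ THE [IV] LEAF AT THE χ-GENERIC STAGE-13 BUNDLE OF RECORD FROM `Provisos₁₃Chi`** (`kSel P < P.K`): the χ-generic `Provisos₁₃Chi.rstep` (integrable form) supplies the knit
datum's provisos AND (1.102) at the pin; displayed: the (1.100) pin equation at the χ-generic ₁₃ tower, the denominator masses, the fibre witness, and EXACTLY Proposition 1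
(1.78), (1.80), (1.89) — the verbatim re-issue of the parent's `b15Leaf_WOfRecord₁₃_of_massSel` in the β-slot `χ`.
[cite: Balaban1989LargeFieldI, (0.2)–(0.6) p.176, p.176 ll.14–16, Prop. 1 (1.78) p.194, (1.80) p.195, (1.89) p.198, (1.99)–(1.102) pp.200–201; Balaban1988Convergent, (3.25) p.270; Balaban1987RG1, (2.9) p.266] -/
theorem b15Leaf_WOfRecord₁₃_of_massSel (hP : θ.Provisos₁₃Chi F N χ) {P : B12.RunParams} (hk : lam.kSel P < P.K)
    (hpin : lam.D1100 P
      = rPrimeDataOfSel (reprTOfRecord₁₃Chi F N θ χ P (lam.kSel P)) (θ.ppSel P (gOfRecord₁₃Chi F N θ χ P) (lam.kSel P + 1))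
          (fibOfSeq F θ.ν θ.τ9 P (gOfRecord₁₃Chi F N θ χ P) (lam.kSel P + 1)))
    (hmassSel : ∀ s, 0 < ∫ V, rterm (reprTOfRecord₁₃Chi F N θ χ P (lam.kSel P)) (θ.ppSel P (gOfRecord₁₃Chi F N θ χ P) (lam.kSel P + 1) s) V
      ∂(fieldMeasure (F.P P.K) (lam.kSel P + 1) (SU N)))
    (hfib : ∀ s, ∃ s', θ.ppSel P (gOfRecord₁₃Chi F N θ χ P) (lam.kSel P + 1) s' = θ.ppSel P (gOfRecord₁₃Chi F N θ χ P) (lam.kSel P + 1) s ∧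
      0 < ∫ V, rterm (reprTOfRecord₁₃Chi F N θ χ P (lam.kSel P)) s' V ∂(fieldMeasure (F.P P.K) (lam.kSel P + 1) (SU N)))
    (hP1 : Prop1Printed (lam.LF P))
    (h180 : ∀ U, new189 (lam.D189 P) U → ∀ i, (lam.D189 P).h ≤ i → i ≤ (lam.D189 P).k → ∀ q ∈ plaqsOf (dom (lam.D189 P) i),
      Ineq180 ((lam.D189 P).dev0 U q) ((lam.D189 P).ε (lam.D189 P).k) (lam.D189 P).η (lam.D189 P).B₃ (lam.D189 P).B₅ (lam.D189 P).M (lam.D189 P).δ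
        ((lam.D189 P).dist q) (lam.D189 P).O1)
    (h189 : Claim189 (new189 (lam.D189 P)) (chiPP (lam.D189 P))) : B15Leaf (WOfRecord₁₃Chi F N θ χ lam P) :=
  b15Leaf_WOfRecord₁₃_of_provisosInt_massSel θ χ lam (provisosInt_reprTOfRecord₁₃_of_provisos₁₃ θ χ hP P (lam.kSel P) hk)
    hpin hmassSel hfib hP1 h180 h189

/-! ### §R. Receipt: at `χ := chiβOfRecord₁₃ θ` the conclusion IS the parent's leaf (definitionally) -/

/-- RECEIPT (`rfl` on the carrier, [Ax-3b] + `WOfRecord₁₃Chi_chiβ`): the χ-generic leaf at the record's own β-slot is the leaf at the bundle of record — so the parent's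
theorem is the instance `χ := chiβOfRecord₁₃ θ` of the one above. [cite: Balaban1989LargeFieldI, (0.2) p.176; Balaban1987RG1, (2.9) p.266 (bookkeeping)] -/
theorem b15Leaf_WOfRecord₁₃Chi_chiβ_iff (P : B12.RunParams) :
    B15Leaf (WOfRecord₁₃Chi F N θ (chiβOfRecord₁₃ F N θ) lam P) ↔ B15Leaf (WOfRecord₁₃ F N θ lam P) := Iff.rfl

end Record13Chi

end Summit.QuantumFields.YangMills.BalabanUVNodes.N12LeafIntAtRecord13Chi

end
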